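import Literature.Analysis.Calculus.IteratedFDerivEquicontinuity
import Literature.Analysis.FunctionSpaces.EquicontinuousExtraction
import Mathlib.Analysis.Calculus.UniformLimitsDeriv
import HarnessLib

/-!
# The `Cᵏ` Arzelà–Ascoli theorem: `C^{k+1}`-bounded sequences have `Cᵏ_loc`-convergent subsequences
(topic `Analysis/Calculus`; Hörmander-style compact embedding `C^{k+1} ↪ Cᵏ` on open sets in
sequential form; Petersen 2006, Ch. 10, §3.1 — the analytic half of Cheeger–Gromov compactness;
Adams–Fournier, *Sobolev Spaces*, 1.34 (Ascoli–Arzelà) with the mean value theorem)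

**Theorem (`exists_strictMono_contDiffOn_tendstoLocallyUniformlyOn_iteratedFDeriv`).** Let `E, F`
be finite-dimensional real normed spaces, `U ⊆ E` open, and `f : ℕ → E → F` a sequence of maps of
class `C^{k+1}` on `U` with, on every compact `K ⊆ U`, a COMMON bound `‖Dⁱ fₙ(x)‖ ≤ Λ_K` for all
`n`, all `i ≤ k + 1` and all `x ∈ K`. Then there are a strictly increasing `φ : ℕ → ℕ` and a map `g` of class `Cᵏ` on `U` such
that for every `i ≤ k` the `i`-th derivatives `Dⁱ f_{φ n}` converge to `Dⁱ g`
(`= iteratedFDerivWithin ℝ i g U`, `= iteratedFDeriv ℝ i g` on `U`) LOCALLY UNIFORMLY on `U`.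

Proof. The family `x ↦ (Dⁱ fₙ(x))_{i ≤ k}` (values in the proper space `Π_{i ≤ k} E[×i]→L F`)
is equicontinuous on `U` (mean value inequality with the bound on `D^{i+1}`,
`IteratedFDerivEquicontinuity.lean`) and pointwise bounded, so by the sequential Arzelà–Ascoli
theorem (`EquicontinuousExtraction.lean`) a subsequence converges locally uniformly to a continuous
`g⃗ = (gᵢ)_{i ≤ k}`. By the differentiable limit theorem
(`hasFDerivAt_of_tendstoLocallyUniformlyOn`), `gᵢ` has derivative `curry(g_{i+1})`, so by
induction `iteratedFDerivWithin ℝ i g U = gᵢ` on `U` for `g = g₀`, which is therefore `Cᵏ`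
(`contDiffOn_of_continuousOn_differentiableOn`).

## References
* [Petersen2006] P. Petersen, *Riemannian Geometry*, 2nd ed., GTM 171, Springer 2006, Ch. 10, §3.1.
* [Conway1978] J. B. Conway, *Functions of One Complex Variable*, 2nd ed., Springer 1978, VII.1.23.
-/

noncomputable section

open Set Metric Filter Topology Function
open scoped ContDiff Topology

namespace Literature.Analysis.Calculus

open Literature.Analysis.FunctionSpaces

variable {E F : Type*} [NormedAddCommGroup E] [NormedSpace ℝ E] [FiniteDimensional ℝ E]
  [NormedAddCommGroup F] [NormedSpace ℝ F] [FiniteDimensional ℝ F]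

/-! ### Finite-dimensionality of the spaces of higher derivatives -/

omit [FiniteDimensional ℝ E] [FiniteDimensional ℝ F] in
/-- For finite-dimensional `E, F` the space `E [×n]→L[ℝ] F` of continuous `n`-multilinear maps is
finite-dimensional (induction via the currying isomorphisms). [folklore] -/
theorem finiteDimensional_continuousMultilinearMap_fin (E F : Type*) [NormedAddCommGroup E]
    [NormedSpace ℝ E] [FiniteDimensional ℝ E] [NormedAddCommGroup F] [NormedSpace ℝ F]
    [FiniteDimensional ℝ F] (n : ℕ) : FiniteDimensional ℝ (E [×n]→L[ℝ] F) := by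
  induction n with
  | zero =>
    exact LinearEquiv.finiteDimensional (continuousMultilinearCurryFin0 ℝ E F).toLinearEquiv.symm
  | succ n ih =>
    haveI := ih
    exact LinearEquiv.finiteDimensional
      (continuousMultilinearCurryLeftEquiv ℝ (fun _ : Fin (n + 1) ↦ E) F).toLinearEquiv.symm

/-! ### Equicontinuity and convergence of finite products of families -/

section Pi

variable {X : Type*} [TopologicalSpace X] {ι : Type*} [Fintype ι] {A : ι → Type*}
  [∀ i, PseudoMetricSpace (A i)]

/-- A finite product of equicontinuous families (sup metric) is equicontinuous. [folklore] -/
theorem equicontinuousAt_pi_of_forall {κ : Type*} {G : κ → X → ∀ i, A i} {x₀ : X}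
    (h : ∀ i, EquicontinuousAt (fun n x ↦ G n x i) x₀) : EquicontinuousAt G x₀ := by
  rw [Metric.equicontinuousAt_iff_right]
  intro ε hε
  have h' : ∀ i, ∀ᶠ x in 𝓝 x₀, ∀ n, dist (G n x₀ i) (G n x i) < ε / 2 := fun i ↦
    Metric.equicontinuousAt_iff_right.1 (h i) _ (half_pos hε)
  filter_upwards [Filter.eventually_all.2 h'] with x hx n
  refine lt_of_le_of_lt ((dist_pi_le_iff (half_pos hε).le).2 fun i ↦ (hx i n).le) ?_
  linarith

end Pi

/-! ### The theorem -/

/-- **The `Cᵏ` Arzelà–Ascoli theorem.** A sequence of `C^{k+1}` maps on an open set `U` of a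
finite-dimensional space with, on every compact subset of `U`, a common bound on all derivatives
of order `≤ k + 1` has a
subsequence whose derivatives of every order `i ≤ k` converge locally uniformly on `U` to those of
a `Cᵏ` map `g` (its `i`-th derivatives within `U`). [cite: Petersen2006, Ch. 10 §3.1] -/
theorem exists_strictMono_contDiffOn_tendstoLocallyUniformlyOn_iteratedFDeriv {U : Set E}
    (hU : IsOpen U) {k : ℕ} {f : ℕ → E → F} (hf : ∀ n, ContDiffOn ℝ (k + 1) (f n) U)
    (hb : ∀ K ⊆ U, IsCompact K →
      ∃ Λ : ℝ, ∀ n, ∀ i, i ≤ k + 1 → ∀ z ∈ K, ‖iteratedFDeriv ℝ i (f n) z‖ ≤ Λ) :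
    ∃ (g : E → F) (φ : ℕ → ℕ), StrictMono φ ∧ ContDiffOn ℝ k g U ∧
      ∀ i, i ≤ k → TendstoLocallyUniformlyOn (fun n ↦ iteratedFDeriv ℝ i (f (φ n)))
        (iteratedFDerivWithin ℝ i g U) atTop U := by
  classical
  -- the vector of derivatives of orders `≤ k`
  let V : Fin (k + 1) → Type _ := fun i ↦ E [×(i : ℕ)]→L[ℝ] F
  let G : ℕ → E → (∀ i : Fin (k + 1), V i) := fun n x i ↦ iteratedFDeriv ℝ i (f n) x
  -- equicontinuity on `U` (local: a bound on a ball around each point suffices)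
  have heq : Equicontinuous fun n ↦ U.restrict (G n) := by
    intro x₀
    obtain ⟨r, hr, hrU⟩ := Metric.isOpen_iff.1 hU x₀ x₀.2
    have hcb : closedBall (x₀ : E) (r / 2) ⊆ U :=
      (closedBall_subset_ball (half_lt_self hr)).trans hrU
    have hball : ball (x₀ : E) (r / 2) ⊆ U := ball_subset_closedBall.trans hcb
    obtain ⟨Λ, hΛ⟩ := hb _ hcb (isCompact_closedBall _ _)
    refine equicontinuousAt_pi_of_forall fun i ↦ ?_
    have hE : EquicontinuousAt (fun n (x : E) ↦ iteratedFDeriv ℝ (i : ℕ) (f n) x) (x₀ : E) :=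
      equicontinuousAt_iteratedFDeriv_of_bound (s := ball (x₀ : E) (r / 2)) isOpen_ball
        (fun j ↦ (hf j).mono hball)
        (by exact_mod_cast Nat.succ_le_succ (Nat.lt_succ_iff.1 i.2))
        (fun j z hz ↦ hΛ j (i + 1) (Nat.succ_le_succ (Nat.lt_succ_iff.1 i.2)) z
          (ball_subset_closedBall hz))
        (mem_ball_self (half_pos hr))
    exact (equicontinuousAt_restrict_iff _ x₀).2 (hE.equicontinuousWithinAt _)
  -- pointwise boundedness
  have hb' : ∀ x ∈ U, ∃ (y₀ : ∀ i : Fin (k + 1), V i) (M : ℝ), ∀ n, dist (G n x) y₀ ≤ M := by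
    intro x hx
    obtain ⟨Λ, hΛ⟩ := hb {x} (singleton_subset_iff.2 hx) isCompact_singleton
    refine ⟨0, Λ, fun n ↦ ?_⟩
    rw [dist_zero_right]
    exact (pi_norm_le_iff_of_nonneg ((norm_nonneg _).trans
      (hΛ n 0 (Nat.zero_le _) x rfl))).2 fun i ↦ hΛ n i i.2.le x rfl
  -- extraction (the value space is finite-dimensional, hence proper)
  haveI : ∀ i : Fin (k + 1), ProperSpace (V i) := fun i ↦ by
    haveI : FiniteDimensional ℝ (V i) := finiteDimensional_continuousMultilinearMap_fin E F i
    exact FiniteDimensional.proper ℝ (V i)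
  obtain ⟨gv, φ, hφ, hgvc, hlim⟩ :=
    exists_strictMono_tendstoLocallyUniformlyOn_of_equicontinuous hU heq hb'
  -- the components converge locally uniformly and are continuous
  have hlimi : ∀ i : Fin (k + 1), TendstoLocallyUniformlyOn
      (fun n x ↦ iteratedFDeriv ℝ (i : ℕ) (f (φ n)) x) (fun x ↦ gv x i) atTop U := fun i ↦
    (Pi.uniformContinuous_proj V i).comp_tendstoLocallyUniformlyOn hlim
  have hgic : ∀ i : Fin (k + 1), ContinuousOn (fun x ↦ gv x i) U := fun i ↦
    (continuous_apply i).comp_continuousOn hgvc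
  -- the limit map
  let g : E → F := fun x ↦ continuousMultilinearCurryFin0 ℝ E F (gv x 0)
  -- identification of the derivatives within `U`, by induction on the order
  have hident : ∀ i : Fin (k + 1), EqOn (iteratedFDerivWithin ℝ (i : ℕ) g U) (fun x ↦ gv x i) U := by
    intro i
    obtain ⟨i, hi⟩ := i
    induction i with
    | zero =>
      intro x hx
      show iteratedFDerivWithin ℝ 0 g U x = gv x 0
      rw [iteratedFDerivWithin_zero_eq_comp]
      show (continuousMultilinearCurryFin0 ℝ E F).symm (continuousMultilinearCurryFin0 ℝ E F _) = _
      rw [LinearIsometryEquiv.symm_apply_apply]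
    | succ m ih =>
      have hm : m < k + 1 := Nat.lt_of_succ_lt hi
      have hmk : m < k := Nat.lt_of_succ_lt_succ hi
      have ih' := ih hm
      -- the derivative of `gv · m` is `curry (gv · (m+1))`
      set Lc := continuousMultilinearCurryLeftEquiv ℝ (fun _ : Fin (m + 1) ↦ E) F with hLc
      have hderiv : ∀ x ∈ U, HasFDerivAt (fun y ↦ gv y ⟨m, hm⟩) (Lc (gv x ⟨m + 1, hi⟩)) x := by
        intro x hx
        refine hasFDerivAt_of_tendstoLocallyUniformlyOn hU (l := atTop)
          (f := fun n y ↦ iteratedFDeriv ℝ m (f (φ n)) y)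
          (f' := fun n y ↦ Lc (iteratedFDeriv ℝ (m + 1) (f (φ n)) y))
          (g' := fun y ↦ Lc (gv y ⟨m + 1, hi⟩)) ?_ ?_ ?_ hx
        · exact Lc.isometry.uniformContinuous.comp_tendstoLocallyUniformlyOn (hlimi ⟨m + 1, hi⟩)
        · intro n y hy
          have hd : DifferentiableAt ℝ (iteratedFDeriv ℝ m (f (φ n))) y :=
            differentiableAt_iteratedFDeriv_of_isOpen hU (hf (φ n)) (by exact_mod_cast hm) hy
          have h := hd.hasFDerivAt
          rwa [fderiv_iteratedFDeriv] at h
        · intro y hy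
          exact (hlimi ⟨m, hm⟩).tendsto_at hy
      intro x hx
      show iteratedFDerivWithin ℝ (m + 1) g U x = gv x ⟨m + 1, hi⟩
      rw [iteratedFDerivWithin_succ_eq_comp_left, Function.comp_apply]
      have hcongr : fderivWithin ℝ (iteratedFDerivWithin ℝ m g U) U x =
          fderivWithin ℝ (fun y ↦ gv y ⟨m, hm⟩) U x :=
        fderivWithin_congr ih' (ih' hx)
      rw [hcongr, fderivWithin_of_isOpen hU hx, (hderiv x hx).fderiv]
      exact (continuousMultilinearCurryLeftEquiv ℝ (fun _ : Fin (m + 1) ↦ E) F).symm_apply_apply _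
  -- `g` is `Cᵏ` on `U`
  have hgk : ContDiffOn ℝ k g U := by
    refine contDiffOn_of_continuousOn_differentiableOn (fun m hm ↦ ?_) (fun m hm ↦ ?_)
    · have hm' : m < k + 1 := by exact_mod_cast Nat.lt_succ_of_le (by exact_mod_cast hm)
      exact (hgic ⟨m, hm'⟩).congr (hident ⟨m, hm'⟩)
    · have hmk : m < k := by exact_mod_cast hm
      have hm1 : m + 1 < k + 1 := Nat.succ_lt_succ hmk
      have hm' : m < k + 1 := Nat.lt_of_succ_lt hm1
      -- differentiability of `gv · m` from the derivative computed above (re-derive it)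
      have hd : ∀ x ∈ U, DifferentiableAt ℝ (fun y ↦ gv y ⟨m, hm'⟩) x := by
        intro x hx
        refine (hasFDerivAt_of_tendstoLocallyUniformlyOn hU (l := atTop)
          (f := fun n y ↦ iteratedFDeriv ℝ m (f (φ n)) y)
          (f' := fun n y ↦ continuousMultilinearCurryLeftEquiv ℝ (fun _ : Fin (m + 1) ↦ E) F
            (iteratedFDeriv ℝ (m + 1) (f (φ n)) y))
          (g' := fun y ↦ continuousMultilinearCurryLeftEquiv ℝ (fun _ : Fin (m + 1) ↦ E) F
            (gv y ⟨m + 1, hm1⟩)) ?_ ?_ ?_ hx).differentiableAt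
        · exact (continuousMultilinearCurryLeftEquiv ℝ (fun _ : Fin (m + 1) ↦ E)
            F).isometry.uniformContinuous.comp_tendstoLocallyUniformlyOn (hlimi ⟨m + 1, hm1⟩)
        · intro n y hy
          have hdd : DifferentiableAt ℝ (iteratedFDeriv ℝ m (f (φ n))) y :=
            differentiableAt_iteratedFDeriv_of_isOpen hU (hf (φ n)) (by exact_mod_cast hm') hy
          have h := hdd.hasFDerivAt
          rwa [fderiv_iteratedFDeriv] at h
        · intro y hy
          exact (hlimi ⟨m, hm'⟩).tendsto_at hy
      exact fun x hx ↦ ((hd x hx).differentiableWithinAt.congr (fun y hy ↦ hident ⟨m, hm'⟩ hy)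
        (hident ⟨m, hm'⟩ hx))
  refine ⟨g, φ, hφ, hgk, fun i hi ↦ ?_⟩
  have hi' : i < k + 1 := Nat.lt_succ_of_le hi
  exact (hlimi ⟨i, hi'⟩).congr_right fun x hx ↦ (hident ⟨i, hi'⟩ hx).symm

/-- **The `Cᵏ` Arzelà–Ascoli theorem, global-derivative form**: as above, with the limits written
as the GLOBAL iterated derivatives `iteratedFDeriv ℝ i g` (equal to the derivatives within the
open set `U` at points of `U`) and uniform convergence on every compact subset of `U`. [cite: Petersen2006, Ch. 10 §3.1] -/
theorem exists_strictMono_contDiffOn_tendstoUniformlyOn_iteratedFDeriv {U : Set E}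
    (hU : IsOpen U) {k : ℕ} {f : ℕ → E → F} (hf : ∀ n, ContDiffOn ℝ (k + 1) (f n) U)
    (hb : ∀ K ⊆ U, IsCompact K →
      ∃ Λ : ℝ, ∀ n, ∀ i, i ≤ k + 1 → ∀ z ∈ K, ‖iteratedFDeriv ℝ i (f n) z‖ ≤ Λ) :
    ∃ (g : E → F) (φ : ℕ → ℕ), StrictMono φ ∧ ContDiffOn ℝ k g U ∧
      ∀ i, i ≤ k → ∀ K ⊆ U, IsCompact K → TendstoUniformlyOn
        (fun n ↦ iteratedFDeriv ℝ i (f (φ n))) (iteratedFDeriv ℝ i g) atTop K := by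
  obtain ⟨g, φ, hφ, hgk, hlim⟩ :=
    exists_strictMono_contDiffOn_tendstoLocallyUniformlyOn_iteratedFDeriv hU hf hb
  refine ⟨g, φ, hφ, hgk, fun i hi K hKU hK ↦ ?_⟩
  have h := (hlim i hi).congr_right (iteratedFDerivWithin_of_isOpen (𝕜 := ℝ) (f := g) i hU)
  exact (tendstoLocallyUniformlyOn_iff_forall_isCompact hU).1 h K hKU hK

/-- **Uniform smallness of all derivatives of order `≤ k` on compacts, eventually**: in the
situation of the `Cᵏ` Arzelà–Ascoli theorem, for every compact `K ⊆ U` and `ε > 0`, eventually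
`‖Dⁱ f_{φ n}(x) − Dⁱ g(x)‖ < ε` for all `i ≤ k` and `x ∈ K` (the form consumed by `Cᵏ` sup-norm
statements). [cite: Petersen2006, Ch. 10 §3.1] -/
theorem exists_strictMono_contDiffOn_eventually_norm_iteratedFDeriv_sub_lt {U : Set E}
    (hU : IsOpen U) {k : ℕ} {f : ℕ → E → F} (hf : ∀ n, ContDiffOn ℝ (k + 1) (f n) U)
    (hb : ∀ K ⊆ U, IsCompact K →
      ∃ Λ : ℝ, ∀ n, ∀ i, i ≤ k + 1 → ∀ z ∈ K, ‖iteratedFDeriv ℝ i (f n) z‖ ≤ Λ) :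
    ∃ (g : E → F) (φ : ℕ → ℕ), StrictMono φ ∧ ContDiffOn ℝ k g U ∧
      ∀ K ⊆ U, IsCompact K → ∀ ε > 0, ∀ᶠ n in atTop, ∀ i, i ≤ k → ∀ x ∈ K,
        ‖iteratedFDeriv ℝ i (f (φ n)) x - iteratedFDeriv ℝ i g x‖ < ε := by
  obtain ⟨g, φ, hφ, hgk, hlim⟩ :=
    exists_strictMono_contDiffOn_tendstoUniformlyOn_iteratedFDeriv hU hf hb
  refine ⟨g, φ, hφ, hgk, fun K hKU hK ε hε ↦ ?_⟩
  have h : ∀ i ∈ Finset.range (k + 1), ∀ᶠ n in atTop, ∀ x ∈ K,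
      ‖iteratedFDeriv ℝ i (f (φ n)) x - iteratedFDeriv ℝ i g x‖ < ε := fun i hi ↦ by
    have hu := hlim i (Nat.lt_succ_iff.1 (Finset.mem_range.1 hi)) K hKU hK
    rw [Metric.tendstoUniformlyOn_iff] at hu
    filter_upwards [hu ε hε] with n hn x hx
    rw [← dist_eq_norm, dist_comm]
    exact hn x hx
  filter_upwards [(Finset.eventually_all (Finset.range (k + 1))).2 h] with n hn i hi x hx
  exact hn i (Finset.mem_range.2 (Nat.lt_succ_of_le hi)) x hx

omit [FiniteDimensional ℝ E] [FiniteDimensional ℝ F] in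
/-- The hypothesis of the `Cᵏ` Arzelà–Ascoli theorem from a UNIFORM bound on the open set. [folklore] -/
theorem locallyBounded_iteratedFDeriv_of_bound {U : Set E} {k : ℕ} {f : ℕ → E → F} {Λ : ℝ}
    (hΛ : ∀ n, ∀ i, i ≤ k + 1 → ∀ z ∈ U, ‖iteratedFDeriv ℝ i (f n) z‖ ≤ Λ) :
    ∀ K ⊆ U, IsCompact K →
      ∃ Λ : ℝ, ∀ n, ∀ i, i ≤ k + 1 → ∀ z ∈ K, ‖iteratedFDeriv ℝ i (f n) z‖ ≤ Λ :=
  fun _ hKU _ ↦ ⟨Λ, fun n i hi z hz ↦ hΛ n i hi z (hKU hz)⟩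

end Literature.Analysis.Calculus
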